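/-
Copyright (c) 2026 the pub-hodgecm-mathlib formalisation cell (harness21).  Prover seat hodgecm-mathlib-K2E3-p31 (g0), HCML Track B, programme R90-TF
(Rogawski 1990 trace formula), section S4 = Ch. 13.1–2 (base `R90-C131`, dealer K2E2-plan (g6), WAVE-2 deal (3) S4#C-SC BY NAME 2026-09-04T16:15:06Z):
«SUPERCUSPIDAL ⇒ SQUARE-INTEGRABLE MODULO THE CENTRE» for ANY topological group — Harish-Chandra's remark `°𝓔(G) ⊂ 𝓔₂(G)` in the smooth category;
= the body of the tree's named fact `Representation.IsSupercuspidal.isSquareIntegrableModCenter`, proved.  2026-09-04.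
-/
import Literature.NumberTheory.Automorphic.MatrixCoefficients                      -- ★ `Representation.IsSupercuspidal`, `IsSquareIntegrableModCenter`, the named fact `IsSupercuspidal.isSquareIntegrableModCenter` (a `Prop`)
import Literature.NumberTheory.Automorphic.SmoothRepresentationLocallyConstant      -- ★ `Representation.IsSmooth.isLocallyConstant_apply` (smooth ⇒ `g ↦ ρ g v` locally constant)
import Literature.NumberTheory.Rogawski1990.U3PrincipalSeriesReducibility           -- ★ `IrrClass.IsSquareIntegrable` (class-level «square-integrable mod centre»)
import Mathlib.MeasureTheory.Function.LpSpace.Indicator                             -- Mathlib `Continuous.memLp_of_hasCompactSupport`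
import Mathlib.Topology.Algebra.Group.Quotient                                      -- Mathlib `QuotientGroup.isOpenQuotientMap_mk`, the topological group `G ⧸ N`
import HarnessLib

/-!
# R90-TF · S4 «Ch. 13.1–2», support file S4#C-SC: A SMOOTH SUPERCUSPIDAL REPRESENTATION WITH UNITARY CENTRAL CHARACTER IS SQUARE-INTEGRABLE MODULO THE CENTRE
# (Harish-Chandra 1970, Part I §3 p. 9 «Obviously `°𝓔(G) ⊂ 𝓔₂(G)`»; Rogawski 1990, §1.6 p. 5, §13.2 Prop. 13.2.2 (a) p. 200)

Cell `hodgecm-mathlib`, crux H413 (`stmt-HodgeConjecture-24833`, lane `--supports … --as helper`, count-neutral); programme R90-TF, section S4 (dealer K2E2-plan (g6));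
consumers: Lines C ED. 1∕2 sockets Prop. 13.2.2 (a) «`Π` square-integrable ∕ supercuspidal ⇒ `ψ_G(Π)` …» (supercuspidal packets ARE square-integrable packets), S1∕S3 (the same
implication on `U(3)_v`, `H_v`).  THEOREMS ONLY (no `def`, no `instance`, no `notation`, no named-fact hypothesis, no `sorry`); ★-only imports; never imports `Lines`.

THE MATHEMATICS (any topological group `G`, any `ℂ`-representation).  The tree's ★ `Representation.IsSupercuspidal` IS Harish-Chandra's SUPPORT condition in the smooth category:
EVERY smooth matrix coefficient `c_{φ,v}(g) = φ(ρ(g)v)` (`φ` in the smooth contragredient) is supported in `C·Z(G)` with `C` compact.  If moreover `ρ` is SMOOTH (so `c_{φ,v}` is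
locally constant, ★ `IsSmooth.isLocallyConstant_apply`) and has a UNITARY central character `ω` (`ρ(z) = ω(z)·id`, `|ω(z)| = 1`), then `|c_{φ,v}|` is `Z(G)`-invariant
(`c(gz) = ω(z)c(g)`), hence DESCENDS to a function `f` on `G ⧸ Z(G)` with `f(ḡ) = |c(g)|`; `f` is continuous (`G → G ⧸ Z(G)` is an open quotient map) and supported in the
closure of the image of `C`, which is compact because `G ⧸ Z(G)` is a topological group, hence an `R₁` space (NO separation hypothesis on `G` is needed); so `f ∈ L²(G ⧸ Z(G), μ)`
for every measure finite on compacts — in particular every Haar measure — and `|c(g)| ≤ f(ḡ)` with equality: `ρ` is ★ `IsSquareIntegrableModCenter μ` (domination form).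
* §1 **`isSquareIntegrableModCenter_of_isSupercuspidal`** — the implication with its honest hypotheses `(hsm : ρ.IsSmooth) (hsc : ρ.IsSupercuspidal) (hω : ρ.HasCentralCharacter ω)
  (hω' : ∀ z, ‖ω z‖ = 1)`, for EVERY measure `μ` on `G ⧸ Z(G)` finite on compacts (Borel).
  Its statement IS the body of the tree's named fact ★ `Representation.IsSupercuspidal.isSquareIntegrableModCenter` (`MatrixCoefficients` :538, a `Prop` stated for Haar `μ`,
  cited but never proved; `rg` 2026-09-04) with `[IsHaarMeasure]` weakened to `[IsFiniteMeasureOnCompacts]`: the one-line discharge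
  `fun μ _ _ hsm hsc _ hω hω' => isSquareIntegrableModCenter_of_isSupercuspidal μ hsm hsc hω hω'` is left to the Literature owner of that `Prop` (closed-form `_holds` lane).
* §2 **`IrrClass.isSquareIntegrable_of_isSupercuspidal`** — class level: a supercuspidal class (★ `IrrClass.IsSupercuspidal`) with a unitary central character is ★
  `IrrClass.IsSquareIntegrable μZ` — the currency of ★ `F0P3cStCharTSStPin` ∕ S4's 13.2.2 sockets; at `U(3)_v` and `G̃_v` the unitary-`ω` binder is print's «`ω_π` unitary»
  (compact centre, resp. `ω_π |_{F^×} = 1` on `E_ε(G̃)`), kept EXPLICIT here (no posited ambient).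

HONEST LABEL: count-neutral helper (generic representation theory; closes no socket by itself); HC_CM is proved only modulo the 7 printed citations (2 remaining named inputs:
hLiu418 = stmt-HodgeConjecture-24832, h413 = stmt-HodgeConjecture-24833) until rung 0 closes.

## References
* [HarishChandra1970] Harish-Chandra (notes by G. van Dijk), *Harmonic Analysis on Reductive p-adic Groups*, LNM 162 (1970), Part I §1 p. 4 (square-integrable mod `Z`),
  §3 p. 9 (supercusp forms; «`°𝓔(G) ⊂ 𝓔₂(G)`»).
* [Rogawski1990] J. D. Rogawski, *Automorphic Representations of Unitary Groups in Three Variables*, Ann. of Math. Stud. 123 (1990), §1.6 p. 5; §13.2 Prop. 13.2.2 (a) p. 200.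
* [BushnellHenniart2006] C. J. Bushnell, G. Henniart, *The Local Langlands Conjecture for GL(2)*, Grundlehren 335 (2006), §10.1–10.2, §17.4.
* [Casselman1995] W. Casselman, *Introduction to the theory of admissible representations of `p`-adic reductive groups* (1995 notes), Prop. 5.2.4, Thm. 5.3.1.
-/

set_option autoImplicit false
set_option linter.dupNamespace false   -- `Summit.HodgeConjecture.HodgeConjecture.…` (D-0017 nested layout)

noncomputable section

open MeasureTheory Filter Topology
open scoped Pointwise
open Literature.NumberTheory.Automorphic

namespace Summit.HodgeConjecture.HodgeConjecture.R90.S4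

/-! ## §1 The implication, for every measure finite on compacts -/

section Generic

variable {G V : Type*} [Group G] [TopologicalSpace G] [IsTopologicalGroup G] [AddCommGroup V] [Module ℂ V]
  [MeasurableSpace (G ⧸ Subgroup.center G)] [BorelSpace (G ⧸ Subgroup.center G)]

omit [TopologicalSpace G] [IsTopologicalGroup G] [MeasurableSpace (G ⧸ Subgroup.center G)] [BorelSpace (G ⧸ Subgroup.center G)] in
/-- **The absolute value of a matrix coefficient with unitary central character is `Z(G)`-invariant**: `‖c_{φ,v}(g z)‖ = ‖c_{φ,v}(g)‖` for `z ∈ Z(G)`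
(`ρ(z) = ω(z)·id`, `|ω(z)| = 1`). [cite: HarishChandra1970, Part I §1 p. 4] -/
theorem norm_matrixCoeff_mul_of_mem_center (ρ : Representation ℂ G V) {ω : Subgroup.center G →* ℂˣ} (hω : ρ.HasCentralCharacter ω)
    (hω' : ∀ z : Subgroup.center G, ‖((ω z : ℂˣ) : ℂ)‖ = 1) (φ : Module.Dual ℂ V) (v : V) (g : G) (z : Subgroup.center G) :
    ‖ρ.matrixCoeff φ v (g * z)‖ = ‖ρ.matrixCoeff φ v g‖ := by
  simp only [Representation.matrixCoeff, map_mul, Module.End.mul_apply, hω.apply z v, map_smul, smul_eq_mul, norm_mul, hω' z, one_mul]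

/-- **SUPERCUSPIDAL ⇒ SQUARE-INTEGRABLE MODULO THE CENTRE** (Harish-Chandra's `°𝓔(G) ⊂ 𝓔₂(G)` in the smooth category, any topological group): a SMOOTH representation `ρ`
all of whose smooth matrix coefficients are supported in `C·Z(G)` with `C` compact (★ `IsSupercuspidal`), with a UNITARY central character `ω`, is ★ `IsSquareIntegrableModCenter μ`
for every Borel measure `μ` on `G ⧸ Z(G)` finite on compacts: `|c_{φ,v}|` descends to a continuous compactly supported — hence `L²` — function `f` on `G ⧸ Z(G)` with
`|c_{φ,v}(g)| = f(ḡ)`.  No separation hypothesis on `G` (`G ⧸ Z(G)` is a topological group, hence `R₁`). [cite: HarishChandra1970, Part I §3 p. 9] [cite: Rogawski1990, §1.6 p. 5]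
[cite: BushnellHenniart2006, §10.1, §17.4] -/
theorem isSquareIntegrableModCenter_of_isSupercuspidal (μ : Measure (G ⧸ Subgroup.center G)) [IsFiniteMeasureOnCompacts μ]
    {ρ : Representation ℂ G V} (hsm : ρ.IsSmooth) (hsc : ρ.IsSupercuspidal) {ω : Subgroup.center G →* ℂˣ} (hω : ρ.HasCentralCharacter ω)
    (hω' : ∀ z : Subgroup.center G, ‖((ω z : ℂˣ) : ℂ)‖ = 1) : ρ.IsSquareIntegrableModCenter μ := by
  intro φ _hφ v
  -- the coefficient, its local constancy and its support datum
  set c : G → ℂ := ρ.matrixCoeff φ v with hc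
  have hcloc : IsLocallyConstant c := (Representation.IsSmooth.isLocallyConstant_apply ρ hsm v).comp (fun w : V => φ w)
  obtain ⟨C, hCc, hsupp⟩ := hsc φ _hφ v
  -- the descended function `f(ḡ) = ‖c g‖`
  set f : G ⧸ Subgroup.center G → ℝ := fun q => ‖c q.out‖ with hf
  have hfmk : ∀ g : G, f (QuotientGroup.mk g) = ‖c g‖ := fun g => by
    obtain ⟨z, hz⟩ := QuotientGroup.mk_out_eq_mul (Subgroup.center G) g
    show ‖c ((QuotientGroup.mk g : G ⧸ Subgroup.center G).out)‖ = ‖c g‖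
    rw [hz]
    exact norm_matrixCoeff_mul_of_mem_center ρ hω hω' φ v g z
  have hfcomp : f ∘ (QuotientGroup.mk : G → G ⧸ Subgroup.center G) = fun g => ‖c g‖ := funext hfmk
  -- `f` is continuous (`c` is locally constant and `G → G ⧸ Z(G)` is an open quotient map)
  have hfcont : Continuous f := by
    rw [(QuotientGroup.isOpenQuotientMap_mk (N := Subgroup.center G)).isQuotientMap.continuous_iff, hfcomp]
    exact hcloc.continuous.norm
  -- `f` is supported in the (compact) closure of the image of `C`
  have hfsupp : Function.support f ⊆ (QuotientGroup.mk : G → G ⧸ Subgroup.center G) '' C := by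
    intro q hq
    rw [Function.mem_support] at hq
    have hq' : c q.out ≠ 0 := fun h0 => hq (by show ‖c q.out‖ = 0; rw [h0, norm_zero])
    obtain ⟨x, hx, z, hz, hxz⟩ := Set.mem_mul.1 (hsupp (Function.mem_support.2 hq'))
    refine ⟨x, hx, ?_⟩
    rw [← QuotientGroup.out_eq' q, ← hxz, QuotientGroup.eq]
    simpa only [mul_inv_cancel_left] using (show x⁻¹ * (x * z) ∈ Subgroup.center G from by rw [inv_mul_cancel_left]; exact hz)
  have hfcs : HasCompactSupport f :=
    IsCompact.of_isClosed_subset ((hCc.image (QuotientGroup.continuous_mk (N := Subgroup.center G))).closure) isClosed_closure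
      (closure_mono hfsupp)
  refine ⟨f, hfcont.memLp_of_hasCompactSupport hfcs, fun g => (hfmk g).symm.le⟩

end Generic

/-! ## §2 Class level: the currency of S4's Prop. 13.2.2 sockets and of ★ `F0P3cStCharTSStPin` -/

/-- **A SUPERCUSPIDAL CLASS WITH UNITARY CENTRAL CHARACTER IS SQUARE-INTEGRABLE MOD CENTRE** (class level: ★ `IrrClass.IsSupercuspidal`, ★ `IrrClass.HasCentralCharacter`,
★ `IrrClass.IsSquareIntegrable`): for every Haar measure `μZ` on `G ⧸ Z(G)`.  «Π supercuspidal ⇒ Π square-integrable» of [Rogawski1990, Prop. 13.2.2 (a)] at the level of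
members. [cite: Rogawski1990, §13.2 Prop. 13.2.2 (a) p. 200; §1.6 p. 5] [cite: HarishChandra1970, Part I §3 p. 9] -/
theorem IrrClass.isSquareIntegrable_of_isSupercuspidal {G : Type} [Group G] [TopologicalSpace G] [IsTopologicalGroup G]
    [MeasurableSpace (G ⧸ Subgroup.center G)] [BorelSpace (G ⧸ Subgroup.center G)]
    (μZ : Measure (G ⧸ Subgroup.center G)) [μZ.IsHaarMeasure] (c : IrrClass G) (hc : c.IsSupercuspidal)
    {ω : Subgroup.center G →* ℂˣ} (hω : c.HasCentralCharacter ω) (hω' : ∀ z : Subgroup.center G, ‖((ω z : ℂˣ) : ℂ)‖ = 1) :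
    c.IsSquareIntegrable μZ := by
  induction c using Quotient.inductionOn with
  | h r =>
    exact IrrClass.isSquareIntegrable_mk μZ r
      (isSquareIntegrableModCenter_of_isSupercuspidal μZ r.isSmooth ((IrrClass.isSupercuspidal_mk r).1 hc)
        ((IrrClass.hasCentralCharacter_mk r ω).1 hω) hω')

end Summit.HodgeConjecture.HodgeConjecture.R90.S4

end
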